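import Mathlib
import HarnessLib
import Summits.HubbardSuperconductivity.HubbardSuperconductivity.Theorems.KLProgrammeKLRegimeEngineGeneralStepAliasArithGraded

/-!
# K3 gen-8-FLOW (stmt 20437, stub (C), «(C)-B-ALIAS-L», located «(C)-S-ROW-GRADING»): THE GENERAL-STEP (B) DOOR'S ALIAS GROUPS, LITERAL, at `Md = 38`
# with GRADED far envelopes — `generalAliasGroups38_le` (cell gate-hubbard-kl, seat p2 g21)

Twin of `…GeneralStepAliasRows.generalAliasGroups_le` (p639714; `Md = 28`, ungraded far envelopes `|β|L²·Ss ≤ Ns`, `Ss′ ≤ Ns′`, `10 ≤ s`).  WHY (KL STATUS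
2026-08-28 15:26Z, located «(C)-S-ROW-GRADING»): the two-leg data of the (B) door at scale `m` have position kernels of range `Λ_m⁻¹ = 32·4^m`, so their lattice
moments of order `k` are naturally `≍ (32·4^m)^k × (order-0 mass)`.  Consequences for the `Md = 28` pricing: (i) with the per-order alias size `Nj ≍ N₀·(32·4^m)ʲ`
the currency `4^m·Nj²·√Rsq⁸U²⁰/(2^60β⁴) ∝ 4^{(2j+1)m}/β⁴` is not β-uniform at deep scales for `j ≥ 2`; (ii) a β-uniform `Ns ≥ |β|L²·Ss` does not exist.  HERE:
(i) TEN MORE SPENT DERIVATIVES, `Md := 38` — alias currency `√Rsq⁸·U³⁰/(2^218·β^14)` (each spent derivative is worth `U/(2^26β)`; `4^{9m}/β^{14} ≤ β^{−5}`, so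
the natural `Nj` are now absorbed uniformly); (ii) GRADED far envelopes `|β|L²·Ss ≤ Ns·((4:ℝ)^m)^s`, `Ss′ ≤ Ns′·((4:ℝ)^m)^s` with `30 ≤ s`, landing in the SAME far
currency `Xv⁴`, `Xv = U/(2^59·klEngPsq P²·klEngRsq R²·β³)` (`…GeneralStepAliasArithGraded.pow_absorb_sq/lin`: `4^m ≤ β/8`, `4/L ≤ Xv ≤ 1/β³`):

* **`generalAliasGroups38_le`**: `A_tree(j) + A_J(j) ≤ (2^29·4^m·Nj² + 2^12 + 2^23·Nj′)·(√Rsq⁸·U³⁰/(2^218·β^14)) + (2^26·4^m·Ns² + 2^9 + 2^20·Ns′)·Xv⁴` at `Md = 38`,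
  every `j ≤ 4`; `generalAliasGroups38_nonneg`.

Inputs: as p639714 with `30 ≤ s` and the two graded far envelopes (`Ns`, `Ns′` are now β-free graded coefficients, natural size `≍ U·C_s·32^s`; `Nj`, `Nj′` per
order as before).  Proofs = the abstract pieces of `…GeneralStepAliasArithGraded`; the four ratios by `…EngineAliasVolume`.  No definitions; nothing asserts
superconductivity.  References: BGM 2006 §2.3 (2.21)–(2.24) [cite: BenfattoGiulianiMastropietro2006].
-/

noncomputable section

namespace Summit.HubbardSuperconductivity.HubbardSuperconductivity.Theorems.EngineV8

set_option linter.dupNamespace false -- summit = problem name (single-conjunct summit), D-0017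

open Real Finset Literature.MathematicalPhysics.QuantumLattice Literature.Probability.LatticeModels
open Summit.HubbardSuperconductivity.HubbardSuperconductivity.Theorems.KLRegimeSplit
open Summit.HubbardSuperconductivity.HubbardSuperconductivity.Theorems.DispersionFlow
open Summit.HubbardSuperconductivity.HubbardSuperconductivity.Theorems.KLProgrammeLegKernels
open scoped Nat

section Groups

variable {L : ℕ} [NeZero L] {P : SplitConsts} {R : RenConsts} (hR : ∀ j, 0 ≤ R.Gfr j) (hR0 : 0 < R.Gfr 0) {W : ℝ} (hW : 0 ≤ W) {β U : ℝ}
  (hβ : klBetaMin ≤ β) (hU : 0 < U) (hU1 : U ≤ 1) {Ξ Θ : ℝ}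
  (hΞ : Ξ = (2 ^ 10 * (1 + Real.pi ^ 8 * (W * U ^ 2) / 2 ^ 11) + ∑ j ∈ range 5, R.Gfr j))
  (hΘ : Θ = (1 + ((∑ j ∈ range 5, R.Gfr j) + Real.pi ^ 8 * W / 2 ^ 11) * |U| / R.Gfr 0))
  (hdoor : R.Gfr 0 * |U| + ((∑ j ∈ range 5, R.Gfr j) + Real.pi ^ 8 * W / 2 ^ 11) * U ^ 2 ≤ 1 / 128) (hL : klEngL₄ P R β U ≤ L) {m : ℕ} (hm : m ≤ nScales β + 1)
  {s : ℕ} (hs : 30 ≤ s) {j : ℕ} (hj : j ≤ 4) {Sj Ss Sj' Ss' Nj Ns Nj' Ns' : ℝ} (hSj0 : 0 ≤ Sj) (hSs0 : 0 ≤ Ss) (hSj'0 : 0 ≤ Sj') (hSs'0 : 0 ≤ Ss')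
  (hNj : |β| * (L : ℝ) ^ 2 * Sj ≤ Nj) (hNs : |β| * (L : ℝ) ^ 2 * Ss ≤ Ns * ((4 : ℝ) ^ m) ^ s) (hNj' : Sj' ≤ Nj') (hNs' : Ss' ≤ Ns' * ((4 : ℝ) ^ m) ^ s)
include hR hR0 hW hβ hU hU1 hΞ hΘ hdoor hL hm hs hj hSj0 hSs0 hSj'0 hSs'0 hNj hNs hNj' hNs'

/-- **THE TWO ALIAS GROUPS OF THE GENERAL-STEP (B) DOOR AT `Md = 38` WITH GRADED FAR ENVELOPES, BOUNDED** — see the module docstring. [cite: BenfattoGiulianiMastropietro2006, §2.3 (2.24)] -/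
theorem generalAliasGroups38_le :
    (4 * (2 * (2 * ((2 * |β| * (L : ℝ) ^ 2 * Sj ^ 2) * ((3 : ℝ) ^ j * (8 * (|(β * (L : ℝ) ^ 2)| * (6 / (klScale klE0 m))) * ((38 ! : ℝ)) ^ 2 * (2 * (4 * (2 * (4 * (4 + (4 : ℝ) ^ m *
      Ξ) * (1 + 16 * (1 + 342) / (klScale klE0 m) * 1) + (2 ^ 10 * (1 : ℝ) * (4 : ℝ) ^ m))) * (1 + 6 / (klScale klE0 m) * ((klScale klE0 m) / 128 + 8 * (R.Gfr 0 * |U| * Θ * ((16 : ℝ) ^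
      m)⁻¹))))) ^ 38 + 8 * (|(β * (L : ℝ) ^ 2)| * (2 / (klScale klE0 m))) * ((38 ! : ℝ)) ^ 2 * (4 * ((4 + (4 : ℝ) ^ m * Ξ) + (2 ^ 10 * (1 : ℝ) * (4 : ℝ) ^ m)) * (1 + 2 * (16 * (1 +
      342) / (klScale klE0 m)) * (1 + (R.Gfr 0 * |U| * Θ * ((16 : ℝ) ^ m)⁻¹)))) ^ 38) * (2 / ((2 * (L / 4 + 1) : ℕ) : ℝ)) ^ (38 - j - 4) * (2 ^ 2 * ∑' k : Fin 2 → ℤ, ∏ c, (1 + (k c :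
      ℝ) ^ 2)⁻¹)))) + (L : ℝ) ^ 2 * (L : ℝ) ^ j * ((8 * (|(β * (L : ℝ) ^ 2)| * (6 / (klScale klE0 m))) * ((0 ! : ℝ)) ^ 2 * (2 * (4 * (2 * (4 * (4 + (4 : ℝ) ^ m * Ξ) * (1 + 16 * (1 +
      342) / (klScale klE0 m) * 1) + (2 ^ 10 * (1 : ℝ) * (4 : ℝ) ^ m))) * (1 + 6 / (klScale klE0 m) * ((klScale klE0 m) / 128 + 8 * (R.Gfr 0 * |U| * Θ * ((16 : ℝ) ^ m)⁻¹))))) ^ 0 + 8 *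
      (|(β * (L : ℝ) ^ 2)| * (2 / (klScale klE0 m))) * ((0 ! : ℝ)) ^ 2 * (4 * ((4 + (4 : ℝ) ^ m * Ξ) + (2 ^ 10 * (1 : ℝ) * (4 : ℝ) ^ m)) * (1 + 2 * (16 * (1 + 342) / (klScale klE0 m))
      * (1 + (R.Gfr 0 * |U| * Θ * ((16 : ℝ) ^ m)⁻¹)))) ^ 0) * ((2 * |β| * (L : ℝ) ^ 2 * Ss ^ 2) / (1 + (L : ℝ) / 4) ^ s)))) + (2 * (2 : ℕ) * ((2 * (2 * ((1 / 4 : ℝ) * ((3 : ℝ) ^ j *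
      (((R.Gfr 0 * |U| * Θ * ((16 : ℝ) ^ m)⁻¹) * (R.Gfr 0 * |U| * Θ * ((16 : ℝ) ^ m)⁻¹) / |(β * (L : ℝ) ^ 2)|) * (8 * (|(β * (L : ℝ) ^ 2)| * (6 / (klScale klE0 m)))) * ((38 ! : ℝ)) ^ 2
      * (2 * (2 * (2 ^ 10 * (1 : ℝ) * (4 : ℝ) ^ m) + 2 * (4 * (2 * (4 * (4 + (4 : ℝ) ^ m * Ξ) * (1 + 16 * (1 + 342) / (klScale klE0 m) * 1) + (2 ^ 10 * (1 : ℝ) * (4 : ℝ) ^ m))) * (1 +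
      6 / (klScale klE0 m) * ((klScale klE0 m) / 128 + 8 * (R.Gfr 0 * |U| * Θ * ((16 : ℝ) ^ m)⁻¹)))))) ^ 38) * (2 / ((2 * (L / 4 + 1) : ℕ) : ℝ)) ^ (38 - j - 4) * (2 ^ 2 * ∑' k : Fin 2
      → ℤ, ∏ c, (1 + (k c : ℝ) ^ 2)⁻¹)))) + (L : ℝ) ^ 2 * (L : ℝ) ^ j * ((((R.Gfr 0 * |U| * Θ * ((16 : ℝ) ^ m)⁻¹) * (R.Gfr 0 * |U| * Θ * ((16 : ℝ) ^ m)⁻¹) / |(β * (L : ℝ) ^ 2)|) * (8 *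
      (|(β * (L : ℝ) ^ 2)| * (6 / (klScale klE0 m)))) * ((0 ! : ℝ)) ^ 2 * (2 * (2 * (2 ^ 10 * (1 : ℝ) * (4 : ℝ) ^ m) + 2 * (4 * (2 * (4 * (4 + (4 : ℝ) ^ m * Ξ) * (1 + 16 * (1 + 342) /
      (klScale klE0 m) * 1) + (2 ^ 10 * (1 : ℝ) * (4 : ℝ) ^ m))) * (1 + 6 / (klScale klE0 m) * ((klScale klE0 m) / 128 + 8 * (R.Gfr 0 * |U| * Θ * ((16 : ℝ) ^ m)⁻¹)))))) ^ 0) * ((1 / 4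
      : ℝ) / (1 + (L : ℝ) / 4) ^ s))) + (2 * (2 * ((1 / 4 * Sj') * ((3 : ℝ) ^ j * (((R.Gfr 0 * |U| * Θ * ((16 : ℝ) ^ m)⁻¹) / |(β * (L : ℝ) ^ 2)| * (8 * (|(β * (L : ℝ) ^ 2)| * (6 /
      (klScale klE0 m))))) * ((R.Gfr 0 * |U| * Θ * ((16 : ℝ) ^ m)⁻¹) / |(β * (L : ℝ) ^ 2)| * (8 * (|(β * (L : ℝ) ^ 2)| * (6 / (klScale klE0 m))))) * ((38 ! : ℝ)) ^ 2 * (2 * (2 * (2 *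
      (2 ^ 10 * (1 : ℝ) * (4 : ℝ) ^ m) + 2 * (4 * (2 * (4 * (4 + (4 : ℝ) ^ m * Ξ) * (1 + 16 * (1 + 342) / (klScale klE0 m) * 1) + (2 ^ 10 * (1 : ℝ) * (4 : ℝ) ^ m))) * (1 + 6 / (klScale
      klE0 m) * ((klScale klE0 m) / 128 + 8 * (R.Gfr 0 * |U| * Θ * ((16 : ℝ) ^ m)⁻¹))))))) ^ 38 + 2 * (((R.Gfr 0 * |U| * Θ * ((16 : ℝ) ^ m)⁻¹) / |(β * (L : ℝ) ^ 2)|) * (8 * (|(β * (L :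
      ℝ) ^ 2)| * (6 / (klScale klE0 m)))) * ((38 ! : ℝ)) ^ 2 * (2 * (2 * (2 ^ 10 * (1 : ℝ) * (4 : ℝ) ^ m) + 2 * (4 * (2 * (4 * (4 + (4 : ℝ) ^ m * Ξ) * (1 + 16 * (1 + 342) / (klScale
      klE0 m) * 1) + (2 ^ 10 * (1 : ℝ) * (4 : ℝ) ^ m))) * (1 + 6 / (klScale klE0 m) * ((klScale klE0 m) / 128 + 8 * (R.Gfr 0 * |U| * Θ * ((16 : ℝ) ^ m)⁻¹)))))) ^ 38)) * (2 / ((2 * (L /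
      4 + 1) : ℕ) : ℝ)) ^ (38 - j - 4) * (2 ^ 2 * ∑' k : Fin 2 → ℤ, ∏ c, (1 + (k c : ℝ) ^ 2)⁻¹)))) + (L : ℝ) ^ 2 * (L : ℝ) ^ j * ((((R.Gfr 0 * |U| * Θ * ((16 : ℝ) ^ m)⁻¹) / |(β * (L :
      ℝ) ^ 2)| * (8 * (|(β * (L : ℝ) ^ 2)| * (6 / (klScale klE0 m))))) * ((R.Gfr 0 * |U| * Θ * ((16 : ℝ) ^ m)⁻¹) / |(β * (L : ℝ) ^ 2)| * (8 * (|(β * (L : ℝ) ^ 2)| * (6 / (klScale klE0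
      m))))) * ((0 ! : ℝ)) ^ 2 * (2 * (2 * (2 * (2 ^ 10 * (1 : ℝ) * (4 : ℝ) ^ m) + 2 * (4 * (2 * (4 * (4 + (4 : ℝ) ^ m * Ξ) * (1 + 16 * (1 + 342) / (klScale klE0 m) * 1) + (2 ^ 10 * (1
      : ℝ) * (4 : ℝ) ^ m))) * (1 + 6 / (klScale klE0 m) * ((klScale klE0 m) / 128 + 8 * (R.Gfr 0 * |U| * Θ * ((16 : ℝ) ^ m)⁻¹))))))) ^ 0 + 2 * (((R.Gfr 0 * |U| * Θ * ((16 : ℝ) ^ m)⁻¹)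
      / |(β * (L : ℝ) ^ 2)|) * (8 * (|(β * (L : ℝ) ^ 2)| * (6 / (klScale klE0 m)))) * ((0 ! : ℝ)) ^ 2 * (2 * (2 * (2 ^ 10 * (1 : ℝ) * (4 : ℝ) ^ m) + 2 * (4 * (2 * (4 * (4 + (4 : ℝ) ^ m
      * Ξ) * (1 + 16 * (1 + 342) / (klScale klE0 m) * 1) + (2 ^ 10 * (1 : ℝ) * (4 : ℝ) ^ m))) * (1 + 6 / (klScale klE0 m) * ((klScale klE0 m) / 128 + 8 * (R.Gfr 0 * |U| * Θ * ((16 : ℝ)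
      ^ m)⁻¹)))))) ^ 0)) * ((1 / 4 * Ss') / (1 + (L : ℝ) / 4) ^ s))))) ≤
      (2 ^ 29 * (4 : ℝ) ^ m * Nj ^ 2 + 2 ^ 12 + 2 ^ 23 * Nj') * (Real.sqrt (klEngRsq R) ^ 8 * U ^ 30 / (2 ^ 218 * β ^ 14)) + (2 ^ 26 * (4 : ℝ) ^ m * Ns ^ 2 + 2 ^ 9 + 2 ^ 20 * Ns') * (U
        / (2 ^ 59 * klEngPsq P ^ 2 * klEngRsq R ^ 2 * β ^ 3)) ^ 4 := by
  have h128 : (128 : ℝ) ≤ β := by simpa [klBetaMin] using hβ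
  have hβ0 : (0 : ℝ) < β := by linarith
  have hLr := klEngL4Real_le_of_klEngL₄_le hL
  have hL4 := four_le_of_klEngL4Real_le hβ hU hU1 hLr
  have hL1 : (1 : ℝ) ≤ L := by exact_mod_cast Nat.one_le_iff_ne_zero.2 (NeZero.ne L)
  have hG0 : 0 ≤ R.Gfr 0 := hR 0
  have hΛ : 0 < (klScale klE0 m) := by unfold klScale klE0; positivity
  have hΞ0 : 0 ≤ Ξ := by rw [hΞ]; exact Xi_nonneg hR hW U
  have hΘ0 : 0 ≤ Θ := by rw [hΘ]; exact Theta_nonneg hR hR0 hW U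
  have hδΛ : (R.Gfr 0 * |U| * Θ * ((16 : ℝ) ^ m)⁻¹) ≤ (klScale klE0 m) / 4 := by
    rw [hΘ]; exact Gfr_mul_Theta_inv_pow_le_klScale_div_four hR0 hdoor m
  have hT : R.Gfr 0 * |U| * Θ ≤ 1 / 128 := by rw [hΘ, Gfr_mul_abs_mul_Theta_eq hR0]; exact hdoor
  have hδ0 : 0 ≤ (R.Gfr 0 * |U| * Θ * ((16 : ℝ) ^ m)⁻¹) := mul_nonneg (mul_nonneg (mul_nonneg hG0 (abs_nonneg U)) hΘ0) (by positivity)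
  have hc : (β * (L : ℝ) ^ 2) ≠ 0 := by positivity
  have hca : |(β * (L : ℝ) ^ 2)| = |β| * (L : ℝ) ^ 2 := by rw [abs_mul, abs_of_nonneg (by positivity : (0 : ℝ) ≤ (L : ℝ) ^ 2)]
  -- the four ratios (…EngineAliasVolume) and their nonnegativity
  have hρ1 := aliasRatio₁_le hG0 hΞ0 hΘ0 zero_le_one m hδΛ (U := U)
  have hρ2 := aliasRatio₂_le hG0 hΞ0 hΘ0 zero_le_one m hδΛ (U := U)
  have hρ3 := aliasRatio₃_le hG0 hΞ0 hΘ0 zero_le_one m hδΛ (U := U)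
  have hρ4 := aliasRatio₄_le hG0 hΞ0 hΘ0 zero_le_one m hδΛ (U := U)
  have hρ10 : 0 ≤ (2 * (4 * (2 * (4 * (4 + (4 : ℝ) ^ m * Ξ) * (1 + 16 * (1 + 342) / (klScale klE0 m) * 1) + (2 ^ 10 * (1 : ℝ) * (4 : ℝ) ^ m))) * (1 + 6 / (klScale klE0 m) * ((klScale klE0 m) / 128
      + 8 * (R.Gfr 0 * |U| * Θ * ((16 : ℝ) ^ m)⁻¹))))) := by positivity
  have hρ20 : 0 ≤ (4 * ((4 + (4 : ℝ) ^ m * Ξ) + (2 ^ 10 * (1 : ℝ) * (4 : ℝ) ^ m)) * (1 + 2 * (16 * (1 + 342) / (klScale klE0 m)) * (1 + (R.Gfr 0 * |U| * Θ * ((16 : ℝ) ^ m)⁻¹)))) := by positivity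
  have hρ30 : 0 ≤ (2 * (2 * (2 ^ 10 * (1 : ℝ) * (4 : ℝ) ^ m) + 2 * (4 * (2 * (4 * (4 + (4 : ℝ) ^ m * Ξ) * (1 + 16 * (1 + 342) / (klScale klE0 m) * 1) + (2 ^ 10 * (1 : ℝ) * (4 : ℝ) ^ m))) * (1 + 6
      / (klScale klE0 m) * ((klScale klE0 m) / 128 + 8 * (R.Gfr 0 * |U| * Θ * ((16 : ℝ) ^ m)⁻¹)))))) := by positivity
  have hρ40 : 0 ≤ (2 * (2 * (2 * (2 ^ 10 * (1 : ℝ) * (4 : ℝ) ^ m) + 2 * (4 * (2 * (4 * (4 + (4 : ℝ) ^ m * Ξ) * (1 + 16 * (1 + 342) / (klScale klE0 m) * 1) + (2 ^ 10 * (1 : ℝ) * (4 : ℝ) ^ m))) * (1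
      + 6 / (klScale klE0 m) * ((klScale klE0 m) / 128 + 8 * (R.Gfr 0 * |U| * Θ * ((16 : ℝ) ^ m)⁻¹))))))) := by positivity
  obtain ⟨hρ1r, hρ1B, hE0, hE⟩ := lastAliasLawSqrt (P := P) hR hW hβ hU hΞ hdoor hLr hm hρ1
  obtain ⟨hρ2r, hρ2B, -, -⟩ := lastAliasLawSqrt (P := P) hR hW hβ hU hΞ hdoor hLr hm hρ2
  obtain ⟨hρ3r, hρ3B, -, -⟩ := lastAliasLawSqrt (P := P) hR hW hβ hU hΞ hdoor hLr hm hρ3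
  obtain ⟨hρ4r, hρ4B, -, -⟩ := lastAliasLawSqrt (P := P) hR hW hβ hU hΞ hdoor hLr hm hρ4
  have hQ := gevreyRow38_le_of_le (U := U) hβ hE0 hE
  -- prefactors
  obtain ⟨hPa, hPa0⟩ := genPrefA_le (c := (β * (L : ℝ) ^ 2)) hG0 hc hΘ0 m hδΛ hT
  obtain ⟨hPb, hPb0⟩ := genPrefB_le (c := (β * (L : ℝ) ^ 2)) hG0 hc hΘ0 m hδΛ
  have hP6 : 0 ≤ 8 * (|(β * (L : ℝ) ^ 2)| * (6 / (klScale klE0 m))) := by positivity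
  have hP2 : 0 ≤ 8 * (|(β * (L : ℝ) ^ 2)| * (2 / (klScale klE0 m))) := by positivity
  have hPsum := genTreePref_eq (β * (L : ℝ) ^ 2) m
  have hX0 : 0 ≤ (2 * |β| * (L : ℝ) ^ 2 * Sj ^ 2) := by positivity
  have hXS0 : 0 ≤ (2 * |β| * (L : ℝ) ^ 2 * Ss ^ 2) := by positivity
  have hNj0 : 0 ≤ Nj := le_trans (by positivity) hNj
  have hsqj : (|β| * (L : ℝ) ^ 2 * Sj) ^ 2 ≤ Nj ^ 2 := pow_le_pow_left₀ (by positivity) hNj 2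
  have hsqs : (|β| * (L : ℝ) ^ 2 * Ss) ^ 2 ≤ (Ns * ((4 : ℝ) ^ m) ^ s) ^ 2 := pow_le_pow_left₀ (by positivity) hNs 2
  -- the graded-weight facts: `1 ≤ 4^m ≤ β/8`, `Xv ≤ 1/β³`
  have hl1 : (1 : ℝ) ≤ (4 : ℝ) ^ m := one_le_pow₀ (by norm_num)
  have hl8 : (4 : ℝ) ^ m ≤ β / 8 := four_pow_le_beta_div_eight hβ hm
  have hβ1 : (1 : ℝ) ≤ β := le_trans (by norm_num) h128
  have hXv : (U / (2 ^ 59 * klEngPsq P ^ 2 * klEngRsq R ^ 2 * β ^ 3)) ≤ 1 / β ^ 3 := xv_le_inv_cube P R hU1 hβ0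
  have h4m : 0 ≤ (4 : ℝ) ^ m := by positivity
  have hXP : (2 * |β| * (L : ℝ) ^ 2 * Sj ^ 2) * (8 * (|(β * (L : ℝ) ^ 2)| * (6 / (klScale klE0 m))) + 8 * (|(β * (L : ℝ) ^ 2)| * (2 / (klScale klE0 m)))) ≤ 2 ^ 12 * (4 : ℝ) ^ m * Nj ^ 2 := by
    rw [hPsum, hca]
    have e : (2 * |β| * (L : ℝ) ^ 2 * Sj ^ 2) * (2 ^ 11 * (4 : ℝ) ^ m * (|β| * (L : ℝ) ^ 2)) = 2 ^ 12 * (4 : ℝ) ^ m * (|β| * (L : ℝ) ^ 2 * Sj) ^ 2 := by ring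
    rw [e]
    exact mul_le_mul_of_nonneg_left hsqj (by positivity)
  have hPXS : (8 * (|(β * (L : ℝ) ^ 2)| * (6 / (klScale klE0 m))) + 8 * (|(β * (L : ℝ) ^ 2)| * (2 / (klScale klE0 m)))) * (2 * |β| * (L : ℝ) ^ 2 * Ss ^ 2) ≤ 2 ^ 12 * (4 : ℝ) ^ m * (Ns * ((4 : ℝ) ^ m) ^ s) ^ 2 := by
    rw [hPsum, hca]
    have e : (2 ^ 11 * (4 : ℝ) ^ m * (|β| * (L : ℝ) ^ 2)) * (2 * |β| * (L : ℝ) ^ 2 * Ss ^ 2) = 2 ^ 12 * (4 : ℝ) ^ m * (|β| * (L : ℝ) ^ 2 * Ss) ^ 2 := by ring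
    rw [e]
    exact mul_le_mul_of_nonneg_left hsqs (by positivity)
  obtain ⟨hS, hS0⟩ := aliasS_le
  obtain ⟨hr1, hr0⟩ := aliasR_le_one L
  have h4L := four_div_le_of_klEngL4Real_le (P := P) (R := R) hU hβ0 hLr
  -- the six pieces
  have hta := genTreeAlias38_le (m := m) hj hX0 hP6 hP2 hXP hρ10 hρ20 hr0 hr1 hρ1r hρ1B hρ2r hρ2B hS0 hS hQ
  have htf := genTreeFar_le_graded hL4 hj hs hP6 hP2 hXS0 (zero_le_one.trans hl1) hl8 hβ1 hPXS h4L hXv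
    (ρ₁ := (2 * (4 * (2 * (4 * (4 + (4 : ℝ) ^ m * Ξ) * (1 + 16 * (1 + 342) / (klScale klE0 m) * 1) + (2 ^ 10 * (1 : ℝ) * (4 : ℝ) ^ m))) * (1 + 6 / (klScale klE0 m) * ((klScale klE0 m) / 128
      + 8 * (R.Gfr 0 * |U| * Θ * ((16 : ℝ) ^ m)⁻¹))))))
    (ρ₂ := (4 * ((4 + (4 : ℝ) ^ m * Ξ) + (2 ^ 10 * (1 : ℝ) * (4 : ℝ) ^ m)) * (1 + 2 * (16 * (1 + 342) / (klScale klE0 m)) * (1 + (R.Gfr 0 * |U| * Θ * ((16 : ℝ) ^ m)⁻¹)))))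
  have hja := genJaAlias38_le hj hPa0 hPa hρ30 hr0 hr1 hρ3r hρ3B hS0 hS hQ
  have hjf := genJaFar_le hL4 hPa0 hPa hj (le_trans (by norm_num) hs) h4L
    (ρ := (2 * (2 * (2 ^ 10 * (1 : ℝ) * (4 : ℝ) ^ m) + 2 * (4 * (2 * (4 * (4 + (4 : ℝ) ^ m * Ξ) * (1 + 16 * (1 + 342) / (klScale klE0 m) * 1) + (2 ^ 10 * (1 : ℝ) * (4 : ℝ) ^ m))) * (1 + 6
      / (klScale klE0 m) * ((klScale klE0 m) / 128 + 8 * (R.Gfr 0 * |U| * Θ * ((16 : ℝ) ^ m)⁻¹)))))))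
  have hjb := genJbAlias38_le hj hPb0 hPb hρ30 hρ40 hr0 hr1 hρ3r hρ3B hρ4r hρ4B hS0 hS hQ hSj'0 hNj'
  have hjbf := genJbFar_le_graded hL4 hPb0 hPb hSs'0 hj hs hl1 hl8 hβ1 hNs' h4L hXv
    (ρ₃ := (2 * (2 * (2 ^ 10 * (1 : ℝ) * (4 : ℝ) ^ m) + 2 * (4 * (2 * (4 * (4 + (4 : ℝ) ^ m * Ξ) * (1 + 16 * (1 + 342) / (klScale klE0 m) * 1) + (2 ^ 10 * (1 : ℝ) * (4 : ℝ) ^ m))) * (1 + 6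
      / (klScale klE0 m) * ((klScale klE0 m) / 128 + 8 * (R.Gfr 0 * |U| * Θ * ((16 : ℝ) ^ m)⁻¹)))))))
    (ρ₄ := (2 * (2 * (2 * (2 ^ 10 * (1 : ℝ) * (4 : ℝ) ^ m) + 2 * (4 * (2 * (4 * (4 + (4 : ℝ) ^ m * Ξ) * (1 + 16 * (1 + 342) / (klScale klE0 m) * 1) + (2 ^ 10 * (1 : ℝ) * (4 : ℝ) ^ m))) * (1
      + 6 / (klScale klE0 m) * ((klScale klE0 m) / 128 + 8 * (R.Gfr 0 * |U| * Θ * ((16 : ℝ) ^ m)⁻¹))))))))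
  have htree := mul_le_mul_of_nonneg_left (add_le_add hta htf) (by norm_num : (0 : ℝ) ≤ 4)
  have hJ := mul_le_mul_of_nonneg_left (add_le_add (add_le_add hja hjf) (add_le_add hjb hjbf)) (by norm_num : (0 : ℝ) ≤ 2 * ((2 : ℕ) : ℝ))
  refine (add_le_add htree hJ).trans (le_of_eq ?_)
  push_cast
  ring

omit hU hU1 hL hm hs hj hSj0 hSs0 hNj hNs hNj' hNs' in
/-- `0 ≤` the two alias groups (`Md = 38`). -/
theorem generalAliasGroups38_nonneg :
    0 ≤ (4 * (2 * (2 * ((2 * |β| * (L : ℝ) ^ 2 * Sj ^ 2) * ((3 : ℝ) ^ j * (8 * (|(β * (L : ℝ) ^ 2)| * (6 / (klScale klE0 m))) * ((38 ! : ℝ)) ^ 2 * (2 * (4 * (2 * (4 * (4 + (4 : ℝ) ^ m *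
      Ξ) * (1 + 16 * (1 + 342) / (klScale klE0 m) * 1) + (2 ^ 10 * (1 : ℝ) * (4 : ℝ) ^ m))) * (1 + 6 / (klScale klE0 m) * ((klScale klE0 m) / 128 + 8 * (R.Gfr 0 * |U| * Θ * ((16 : ℝ) ^
      m)⁻¹))))) ^ 38 + 8 * (|(β * (L : ℝ) ^ 2)| * (2 / (klScale klE0 m))) * ((38 ! : ℝ)) ^ 2 * (4 * ((4 + (4 : ℝ) ^ m * Ξ) + (2 ^ 10 * (1 : ℝ) * (4 : ℝ) ^ m)) * (1 + 2 * (16 * (1 +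
      342) / (klScale klE0 m)) * (1 + (R.Gfr 0 * |U| * Θ * ((16 : ℝ) ^ m)⁻¹)))) ^ 38) * (2 / ((2 * (L / 4 + 1) : ℕ) : ℝ)) ^ (38 - j - 4) * (2 ^ 2 * ∑' k : Fin 2 → ℤ, ∏ c, (1 + (k c :
      ℝ) ^ 2)⁻¹)))) + (L : ℝ) ^ 2 * (L : ℝ) ^ j * ((8 * (|(β * (L : ℝ) ^ 2)| * (6 / (klScale klE0 m))) * ((0 ! : ℝ)) ^ 2 * (2 * (4 * (2 * (4 * (4 + (4 : ℝ) ^ m * Ξ) * (1 + 16 * (1 +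
      342) / (klScale klE0 m) * 1) + (2 ^ 10 * (1 : ℝ) * (4 : ℝ) ^ m))) * (1 + 6 / (klScale klE0 m) * ((klScale klE0 m) / 128 + 8 * (R.Gfr 0 * |U| * Θ * ((16 : ℝ) ^ m)⁻¹))))) ^ 0 + 8 *
      (|(β * (L : ℝ) ^ 2)| * (2 / (klScale klE0 m))) * ((0 ! : ℝ)) ^ 2 * (4 * ((4 + (4 : ℝ) ^ m * Ξ) + (2 ^ 10 * (1 : ℝ) * (4 : ℝ) ^ m)) * (1 + 2 * (16 * (1 + 342) / (klScale klE0 m))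
      * (1 + (R.Gfr 0 * |U| * Θ * ((16 : ℝ) ^ m)⁻¹)))) ^ 0) * ((2 * |β| * (L : ℝ) ^ 2 * Ss ^ 2) / (1 + (L : ℝ) / 4) ^ s)))) + (2 * (2 : ℕ) * ((2 * (2 * ((1 / 4 : ℝ) * ((3 : ℝ) ^ j *
      (((R.Gfr 0 * |U| * Θ * ((16 : ℝ) ^ m)⁻¹) * (R.Gfr 0 * |U| * Θ * ((16 : ℝ) ^ m)⁻¹) / |(β * (L : ℝ) ^ 2)|) * (8 * (|(β * (L : ℝ) ^ 2)| * (6 / (klScale klE0 m)))) * ((38 ! : ℝ)) ^ 2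
      * (2 * (2 * (2 ^ 10 * (1 : ℝ) * (4 : ℝ) ^ m) + 2 * (4 * (2 * (4 * (4 + (4 : ℝ) ^ m * Ξ) * (1 + 16 * (1 + 342) / (klScale klE0 m) * 1) + (2 ^ 10 * (1 : ℝ) * (4 : ℝ) ^ m))) * (1 +
      6 / (klScale klE0 m) * ((klScale klE0 m) / 128 + 8 * (R.Gfr 0 * |U| * Θ * ((16 : ℝ) ^ m)⁻¹)))))) ^ 38) * (2 / ((2 * (L / 4 + 1) : ℕ) : ℝ)) ^ (38 - j - 4) * (2 ^ 2 * ∑' k : Fin 2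
      → ℤ, ∏ c, (1 + (k c : ℝ) ^ 2)⁻¹)))) + (L : ℝ) ^ 2 * (L : ℝ) ^ j * ((((R.Gfr 0 * |U| * Θ * ((16 : ℝ) ^ m)⁻¹) * (R.Gfr 0 * |U| * Θ * ((16 : ℝ) ^ m)⁻¹) / |(β * (L : ℝ) ^ 2)|) * (8 *
      (|(β * (L : ℝ) ^ 2)| * (6 / (klScale klE0 m)))) * ((0 ! : ℝ)) ^ 2 * (2 * (2 * (2 ^ 10 * (1 : ℝ) * (4 : ℝ) ^ m) + 2 * (4 * (2 * (4 * (4 + (4 : ℝ) ^ m * Ξ) * (1 + 16 * (1 + 342) /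
      (klScale klE0 m) * 1) + (2 ^ 10 * (1 : ℝ) * (4 : ℝ) ^ m))) * (1 + 6 / (klScale klE0 m) * ((klScale klE0 m) / 128 + 8 * (R.Gfr 0 * |U| * Θ * ((16 : ℝ) ^ m)⁻¹)))))) ^ 0) * ((1 / 4
      : ℝ) / (1 + (L : ℝ) / 4) ^ s))) + (2 * (2 * ((1 / 4 * Sj') * ((3 : ℝ) ^ j * (((R.Gfr 0 * |U| * Θ * ((16 : ℝ) ^ m)⁻¹) / |(β * (L : ℝ) ^ 2)| * (8 * (|(β * (L : ℝ) ^ 2)| * (6 /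
      (klScale klE0 m))))) * ((R.Gfr 0 * |U| * Θ * ((16 : ℝ) ^ m)⁻¹) / |(β * (L : ℝ) ^ 2)| * (8 * (|(β * (L : ℝ) ^ 2)| * (6 / (klScale klE0 m))))) * ((38 ! : ℝ)) ^ 2 * (2 * (2 * (2 *
      (2 ^ 10 * (1 : ℝ) * (4 : ℝ) ^ m) + 2 * (4 * (2 * (4 * (4 + (4 : ℝ) ^ m * Ξ) * (1 + 16 * (1 + 342) / (klScale klE0 m) * 1) + (2 ^ 10 * (1 : ℝ) * (4 : ℝ) ^ m))) * (1 + 6 / (klScale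
      klE0 m) * ((klScale klE0 m) / 128 + 8 * (R.Gfr 0 * |U| * Θ * ((16 : ℝ) ^ m)⁻¹))))))) ^ 38 + 2 * (((R.Gfr 0 * |U| * Θ * ((16 : ℝ) ^ m)⁻¹) / |(β * (L : ℝ) ^ 2)|) * (8 * (|(β * (L :
      ℝ) ^ 2)| * (6 / (klScale klE0 m)))) * ((38 ! : ℝ)) ^ 2 * (2 * (2 * (2 ^ 10 * (1 : ℝ) * (4 : ℝ) ^ m) + 2 * (4 * (2 * (4 * (4 + (4 : ℝ) ^ m * Ξ) * (1 + 16 * (1 + 342) / (klScale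
      klE0 m) * 1) + (2 ^ 10 * (1 : ℝ) * (4 : ℝ) ^ m))) * (1 + 6 / (klScale klE0 m) * ((klScale klE0 m) / 128 + 8 * (R.Gfr 0 * |U| * Θ * ((16 : ℝ) ^ m)⁻¹)))))) ^ 38)) * (2 / ((2 * (L /
      4 + 1) : ℕ) : ℝ)) ^ (38 - j - 4) * (2 ^ 2 * ∑' k : Fin 2 → ℤ, ∏ c, (1 + (k c : ℝ) ^ 2)⁻¹)))) + (L : ℝ) ^ 2 * (L : ℝ) ^ j * ((((R.Gfr 0 * |U| * Θ * ((16 : ℝ) ^ m)⁻¹) / |(β * (L :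
      ℝ) ^ 2)| * (8 * (|(β * (L : ℝ) ^ 2)| * (6 / (klScale klE0 m))))) * ((R.Gfr 0 * |U| * Θ * ((16 : ℝ) ^ m)⁻¹) / |(β * (L : ℝ) ^ 2)| * (8 * (|(β * (L : ℝ) ^ 2)| * (6 / (klScale klE0
      m))))) * ((0 ! : ℝ)) ^ 2 * (2 * (2 * (2 * (2 ^ 10 * (1 : ℝ) * (4 : ℝ) ^ m) + 2 * (4 * (2 * (4 * (4 + (4 : ℝ) ^ m * Ξ) * (1 + 16 * (1 + 342) / (klScale klE0 m) * 1) + (2 ^ 10 * (1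
      : ℝ) * (4 : ℝ) ^ m))) * (1 + 6 / (klScale klE0 m) * ((klScale klE0 m) / 128 + 8 * (R.Gfr 0 * |U| * Θ * ((16 : ℝ) ^ m)⁻¹))))))) ^ 0 + 2 * (((R.Gfr 0 * |U| * Θ * ((16 : ℝ) ^ m)⁻¹)
      / |(β * (L : ℝ) ^ 2)|) * (8 * (|(β * (L : ℝ) ^ 2)| * (6 / (klScale klE0 m)))) * ((0 ! : ℝ)) ^ 2 * (2 * (2 * (2 ^ 10 * (1 : ℝ) * (4 : ℝ) ^ m) + 2 * (4 * (2 * (4 * (4 + (4 : ℝ) ^ m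
      * Ξ) * (1 + 16 * (1 + 342) / (klScale klE0 m) * 1) + (2 ^ 10 * (1 : ℝ) * (4 : ℝ) ^ m))) * (1 + 6 / (klScale klE0 m) * ((klScale klE0 m) / 128 + 8 * (R.Gfr 0 * |U| * Θ * ((16 : ℝ)
      ^ m)⁻¹)))))) ^ 0)) * ((1 / 4 * Ss') / (1 + (L : ℝ) / 4) ^ s))))) := by
  have h128 : (128 : ℝ) ≤ β := by simpa [klBetaMin] using hβ
  have hβ0 : (0 : ℝ) < β := by linarith
  have hL1 : (1 : ℝ) ≤ L := by exact_mod_cast Nat.one_le_iff_ne_zero.2 (NeZero.ne L)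
  have hG0 : 0 ≤ R.Gfr 0 := hR 0
  have hΛ : 0 < (klScale klE0 m) := by unfold klScale klE0; positivity
  have hΞ0 : 0 ≤ Ξ := by rw [hΞ]; exact Xi_nonneg hR hW U
  have hΘ0 : 0 ≤ Θ := by rw [hΘ]; exact Theta_nonneg hR hR0 hW U
  have hδΛ : (R.Gfr 0 * |U| * Θ * ((16 : ℝ) ^ m)⁻¹) ≤ (klScale klE0 m) / 4 := by
    rw [hΘ]; exact Gfr_mul_Theta_inv_pow_le_klScale_div_four hR0 hdoor m
  have hT : R.Gfr 0 * |U| * Θ ≤ 1 / 128 := by rw [hΘ, Gfr_mul_abs_mul_Theta_eq hR0]; exact hdoor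
  have hc : (β * (L : ℝ) ^ 2) ≠ 0 := by positivity
  obtain ⟨-, hPa0⟩ := genPrefA_le (c := (β * (L : ℝ) ^ 2)) hG0 hc hΘ0 m hδΛ hT
  obtain ⟨-, hPb0⟩ := genPrefB_le (c := (β * (L : ℝ) ^ 2)) hG0 hc hΘ0 m hδΛ
  have hP6 : 0 ≤ 8 * (|(β * (L : ℝ) ^ 2)| * (6 / (klScale klE0 m))) := by positivity
  have hP2 : 0 ≤ 8 * (|(β * (L : ℝ) ^ 2)| * (2 / (klScale klE0 m))) := by positivity
  have hX0 : 0 ≤ (2 * |β| * (L : ℝ) ^ 2 * Sj ^ 2) := by positivity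
  have hXS0 : 0 ≤ (2 * |β| * (L : ℝ) ^ 2 * Ss ^ 2) := by positivity
  obtain ⟨-, hS0⟩ := aliasS_le
  obtain ⟨-, hr0⟩ := aliasR_le_one L
  have hta := genTreeAlias38_nonneg j hX0 hP6 hP2 hr0 hS0
    (ρ₁ := (2 * (4 * (2 * (4 * (4 + (4 : ℝ) ^ m * Ξ) * (1 + 16 * (1 + 342) / (klScale klE0 m) * 1) + (2 ^ 10 * (1 : ℝ) * (4 : ℝ) ^ m))) * (1 + 6 / (klScale klE0 m) * ((klScale klE0 m) / 128
      + 8 * (R.Gfr 0 * |U| * Θ * ((16 : ℝ) ^ m)⁻¹))))))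
    (ρ₂ := (4 * ((4 + (4 : ℝ) ^ m * Ξ) + (2 ^ 10 * (1 : ℝ) * (4 : ℝ) ^ m)) * (1 + 2 * (16 * (1 + 342) / (klScale klE0 m)) * (1 + (R.Gfr 0 * |U| * Θ * ((16 : ℝ) ^ m)⁻¹)))))
  have htf := genTreeFar_nonneg L j s hP6 hP2 hXS0
    (ρ₁ := (2 * (4 * (2 * (4 * (4 + (4 : ℝ) ^ m * Ξ) * (1 + 16 * (1 + 342) / (klScale klE0 m) * 1) + (2 ^ 10 * (1 : ℝ) * (4 : ℝ) ^ m))) * (1 + 6 / (klScale klE0 m) * ((klScale klE0 m) / 128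
      + 8 * (R.Gfr 0 * |U| * Θ * ((16 : ℝ) ^ m)⁻¹))))))
    (ρ₂ := (4 * ((4 + (4 : ℝ) ^ m * Ξ) + (2 ^ 10 * (1 : ℝ) * (4 : ℝ) ^ m)) * (1 + 2 * (16 * (1 + 342) / (klScale klE0 m)) * (1 + (R.Gfr 0 * |U| * Θ * ((16 : ℝ) ^ m)⁻¹)))))
  have hja := genJaAlias38_nonneg j hPa0 hr0 hS0
    (ρ := (2 * (2 * (2 ^ 10 * (1 : ℝ) * (4 : ℝ) ^ m) + 2 * (4 * (2 * (4 * (4 + (4 : ℝ) ^ m * Ξ) * (1 + 16 * (1 + 342) / (klScale klE0 m) * 1) + (2 ^ 10 * (1 : ℝ) * (4 : ℝ) ^ m))) * (1 + 6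
      / (klScale klE0 m) * ((klScale klE0 m) / 128 + 8 * (R.Gfr 0 * |U| * Θ * ((16 : ℝ) ^ m)⁻¹)))))))
  have hjf := genJaFar_nonneg L hPa0 j s
    (ρ := (2 * (2 * (2 ^ 10 * (1 : ℝ) * (4 : ℝ) ^ m) + 2 * (4 * (2 * (4 * (4 + (4 : ℝ) ^ m * Ξ) * (1 + 16 * (1 + 342) / (klScale klE0 m) * 1) + (2 ^ 10 * (1 : ℝ) * (4 : ℝ) ^ m))) * (1 + 6
      / (klScale klE0 m) * ((klScale klE0 m) / 128 + 8 * (R.Gfr 0 * |U| * Θ * ((16 : ℝ) ^ m)⁻¹)))))))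
  have hjb := genJbAlias38_nonneg j hPb0 hr0 hS0 hSj'0
    (ρ₃ := (2 * (2 * (2 ^ 10 * (1 : ℝ) * (4 : ℝ) ^ m) + 2 * (4 * (2 * (4 * (4 + (4 : ℝ) ^ m * Ξ) * (1 + 16 * (1 + 342) / (klScale klE0 m) * 1) + (2 ^ 10 * (1 : ℝ) * (4 : ℝ) ^ m))) * (1 + 6
      / (klScale klE0 m) * ((klScale klE0 m) / 128 + 8 * (R.Gfr 0 * |U| * Θ * ((16 : ℝ) ^ m)⁻¹)))))))
    (ρ₄ := (2 * (2 * (2 * (2 ^ 10 * (1 : ℝ) * (4 : ℝ) ^ m) + 2 * (4 * (2 * (4 * (4 + (4 : ℝ) ^ m * Ξ) * (1 + 16 * (1 + 342) / (klScale klE0 m) * 1) + (2 ^ 10 * (1 : ℝ) * (4 : ℝ) ^ m))) * (1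
      + 6 / (klScale klE0 m) * ((klScale klE0 m) / 128 + 8 * (R.Gfr 0 * |U| * Θ * ((16 : ℝ) ^ m)⁻¹))))))))
  have hjbf := genJbFar_nonneg L hPb0 hSs'0 j s
    (ρ₃ := (2 * (2 * (2 ^ 10 * (1 : ℝ) * (4 : ℝ) ^ m) + 2 * (4 * (2 * (4 * (4 + (4 : ℝ) ^ m * Ξ) * (1 + 16 * (1 + 342) / (klScale klE0 m) * 1) + (2 ^ 10 * (1 : ℝ) * (4 : ℝ) ^ m))) * (1 + 6
      / (klScale klE0 m) * ((klScale klE0 m) / 128 + 8 * (R.Gfr 0 * |U| * Θ * ((16 : ℝ) ^ m)⁻¹)))))))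
    (ρ₄ := (2 * (2 * (2 * (2 ^ 10 * (1 : ℝ) * (4 : ℝ) ^ m) + 2 * (4 * (2 * (4 * (4 + (4 : ℝ) ^ m * Ξ) * (1 + 16 * (1 + 342) / (klScale klE0 m) * 1) + (2 ^ 10 * (1 : ℝ) * (4 : ℝ) ^ m))) * (1
      + 6 / (klScale klE0 m) * ((klScale klE0 m) / 128 + 8 * (R.Gfr 0 * |U| * Θ * ((16 : ℝ) ^ m)⁻¹))))))))
  have h1 := mul_nonneg (by norm_num : (0 : ℝ) ≤ 4) (add_nonneg hta htf)
  have h2 := mul_nonneg (by norm_num : (0 : ℝ) ≤ 2 * ((2 : ℕ) : ℝ)) (add_nonneg (add_nonneg hja hjf) (add_nonneg hjb hjbf))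
  exact add_nonneg h1 h2

end Groups

end Summit.HubbardSuperconductivity.HubbardSuperconductivity.Theorems.EngineV8

end
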